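import Literature.MathematicalPhysics.QuantumLattice.HeisenbergSectorEnclosureCertificate
import Summits.Ventures.CertifiedQuantumChemistry.Rows.HeisenbergSpinHalfPerron
import HarnessLib

/-!
# Ventures/CertifiedQuantumChemistry — Rows/HeisenbergRingL8GroundEnergy.lean: the exact ground-state energy of
# the spin-½ antiferromagnetic Heisenberg ring of 8 sites, `E₀ = 2 − μ/4` with `μ³ − 40μ² + 464μ − 1600 = 0`,
# `μ ∈ [22.6043736356, 22.6043736358]` (T-H8(α), part 2 of 2: the constant `h(8) = 2 − E₀ = μ/4` as a KERNEL theorem)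

HONEST FRAMING (verbatim): certified bounds for a stated model Hamiltonian in a stated basis; not a
claim about the real molecule beyond that model.

Seat ref/typer (`pub-qchem-typer`, gen 21). The `L = 8` item INVITED by the lead (HOME/INBOX L888 / L891,
RULINGS TYP-65 / TYP-68: 'T-H8(α) — a KERNEL theorem on `(heisenbergHamiltonian 1 (ringGraph 8) 1).groundEnergy`
… stays invited, never critical-path'); the exact two-sided enclosure T-H8(β) of record is the stdlib deposit
`HOME/pub-qchem-typer/h8-cert/` (`h(8) ∈ [5.6510934089, 5.6510934092]`, RULE ENC-8's h-input). THIS FILE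
proves MORE than an enclosure: the EXACT algebraic value. THEOREMS + the explicit finite data they are about
(`def`s of tables and of one explicit vector; no claim node, no row, no certificate file), zero compute
(kernel evaluation only), standard axioms; NOT a row, scores nothing, moves no `CERTIFIED.md` byte.

## Statement

Let `H = Σ_{i ∈ ℤ/8} 𝐒_i·𝐒_{i+1}` be the tree object `heisenbergHamiltonian 1 (ringGraph 8) 1` (spin ½, `J = 1`,
`2⁸ = 256`-dimensional). Then (`groundEnergy_eq_of_root`, `groundEnergy_eq`, `groundEnergy_mem_Icc`)

  `E₀(H) = 2 − μ/4`, where `μ` is the root of `x³ − 40x² + 464x − 1600` in `[22.6, 22.61]`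
  (it lies in `[22.6043736356, 22.6043736358]`), so `E₀(H) ∈ [−3.65109340895, −3.6510934089]` and
  `h(8) := 2 − E₀(H) = μ/4 ∈ [5.6510934089, 5.65109340895]`

(`μ = 22.6043736357…`, `E₀ = −3.6510934089…`; the other two roots of the cubic are `6.49…`, `10.90…`). With
`Rows/HubbardHalfFilledHeisenbergSpinLimit.lean` ((S): `U·E_(4,4)(hubbardRingTV 8 1 U) → 4·E₀(H) − 8`) this is
`lim_{U→∞} U·E₀(8;U) = −μ` for the half-filled Hubbard 8-ring — stated in the sibling file that imports (S).

## Proof (Perron–Frobenius identification with an explicit Perron vector over `ℤ[μ]`)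

Part 1 (`Rows/HeisenbergSpinHalfPerron.lean`) supplies the bond-by-bond action of the spin-½ Hamiltonian on a wave
function (`heisenbergHamiltonian_one_mulVec_apply`), the Perron–Frobenius identification of a sector energy by a
strictly Marshall-positive eigenvector (`lowestEnergyInSector_eq_of_marshall_positive`, from the tree's
Marshall–Lieb–Mattis theorem `LiebMattis.sector_perronFrobenius`) and the ring's bond sum
(`sum_edgeFinset_ringGraph_eight`). Here:

* §5 the data (namespace `HeisenbergRing8`): the `70` weight-`4` configurations fall into `7` classes under the
  `32` lattice symmetries × spin flip (table `clsTab`, 3 bits per bit-mask); the Perron vector is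
  `φ(σ) = (−1)^{σ_0+σ_2+σ_4+σ_6} · P_{cls σ}(μ)` with `P_k = a_k + b_k μ + c_k μ²`,
  `(a,b,c)_k = (304,−36,1), (96,−4,0), (−416,64,−2), (−64,4,0), (144,−28,1), (864,−128,4), (64,0,0)`
  (`coefA/B/C`; values `≈ 1.20, 5.58, 8.76, 26.42, 22.04, 14.47, 64`, all `> 0` for `μ ∈ [22.6, 22.61]`:
  `coef_pos`). The eigen-equation `4(Hφ)(σ) = 4(2 − μ/4)φ(σ)` is, coefficient by coefficient in `1, μ, μ²` after
  `μ³ ↦ 40μ² − 464μ + 1600`, THREE INTEGER IDENTITIES per configuration (`resid coefA rhsA σ = 0`, …), checked by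
  the kernel over the `256` bit-masks (`resid_cfg_eq_zero`, `decide`; `cfg_enc` transports masks ↔ configurations).
* §6 assembly: `Hφ = (2 − μ/4)φ` (`mulVec_vec`), `φ` lies in the `S^z = 0` sector, is nonzero and Marshall-positive
  (`marshallSign (evenSites 8) σ · φ(σ) = P_{cls σ}(μ) > 0`), the 8-ring is connected and bipartite in the even
  sites with `|A| = |Aᶜ|`, so §3 gives `E(S^z=0) = 2 − μ/4`, and `E(S^z=0) = E₀` by
  `LiebMattis.lowestEnergyInSector_central_eq_groundEnergy`; the root `μ` exists in the stated interval by the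
  intermediate value theorem (`exists_root`), and is unique there a fortiori (`E₀` is one number: `root_unique`).

Independent stdlib numerics (`HOME/pub-qchem-typer/staged/g21/ring8_exact.py`): the `70 × 70` sector matrix, the
gauged off-diagonal sign `−½`, the `7` orbits, the orbit matrix, the null vector of `B − (2 − μ/4)` over `ℚ(μ)` by
exact elimination, and all `3 × 70` integer identities re-derived in `fractions`; `μ = 22.604373635699…` agrees with
T-H8(β)'s `4·h(8) ∈ [22.6043736356, 22.6043736368]` and with `HOME/pub-qchem-typer/staged/g20/heis8.py`
(`x³ − 40x² + 464x − 1600` = the cubic factor of the symmetric `7 × 7` block's characteristic polynomial).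

References: Marshall, Proc. Roy. Soc. A 232 (1955) 48 [Marshall1955]; Lieb–Mattis, J. Math. Phys. 3 (1962) 749,
Thm 2 [LiebMattis1962]; Tasaki (2020) §2.4, Thm 2.3 [Tasaki2020]; finite-ring ground-state energies
(here `E₀(8)/8 = −0.45638…`, i.e. `(E₀ − E_F)/N = −0.70638…` below the ferromagnetic `E_F = N/4 = 2`) are the
classical exact finite-chain values of Bonner–Fisher, Phys. Rev. 135 (1964) A640, recomputed from the Bethe ansatz
equations in Karbach–Hu–Müller, Computers in Physics 12 (1998) 565 (arXiv:cond-mat/9809163), Table I. Typer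
`pub-qchem-typer` (gen 21), 0 core-h.
-/
noncomputable section

namespace Summit.Ventures.CertifiedQuantumChemistry

open Matrix Finset
open Literature.MathematicalPhysics.QuantumLattice

/-! ## §5 The data of the 8-ring: orbit classes, the Perron vector over `ℤ[μ]`, and the kernel check -/

namespace HeisenbergRing8

/-- Orbit-class table of the spin configurations of the 8-ring, 3 bits per configuration mask `m < 256`:
classes `0`–`6` of the `70` weight-`4` configurations under rotations, reflections and the global spin
flip (representatives `00001111`, `00010111`, `00011011`, `00101011`, `00101101`, `00110011`, `01010101`);
`7` = not of weight `4`. -/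
def clsTab : ℕ :=
  1552518092300670325581164813649775372446722196815330151268693325334435838082516690464502182374717837160589684083183014838985748678202034949615016330350125479286252351341243336093916327251854607779251181937875617142751000199742619647

/-- The orbit class of the configuration with mask `m`. -/
def cls (m : ℕ) : ℕ := (clsTab >>> (3 * m)) &&& 7

/-- Perron-vector coefficients `a_k` (value on class `k` is `a_k + b_k μ + c_k μ²`). -/
def coefA : ℕ → ℤ
  | 0 => 304 | 1 => 96 | 2 => -416 | 3 => -64 | 4 => 144 | 5 => 864 | _ => 64

/-- Perron-vector coefficients `b_k`. -/
def coefB : ℕ → ℤ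
  | 0 => -36 | 1 => -4 | 2 => 64 | 3 => 4 | 4 => -28 | 5 => -128 | _ => 0

/-- Perron-vector coefficients `c_k`. -/
def coefC : ℕ → ℤ
  | 0 => 1 | 2 => -2 | 4 => 1 | 5 => 4 | _ => 0

/-- The bit-mask of a spin-½ configuration of the 8-ring (`bit i = σ_i`). -/
def enc (σ : Fin 8 → Fin 2) : ℕ :=
  (σ 0).val + 2 * ((σ 1).val + 2 * ((σ 2).val + 2 * ((σ 3).val + 2 * ((σ 4).val + 2 * ((σ 5).val +
    2 * ((σ 6).val + 2 * (σ 7).val))))))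

/-- The configuration with a given bit-mask. -/
def cfg (m : ℕ) : Fin 8 → Fin 2 := fun i => if m.testBit i.val then 1 else 0

/-- The Marshall sign `(-1)^{σ_0 + σ_2 + σ_4 + σ_6}` (sublattice = even sites) as an integer. -/
def msZ (σ : Fin 8 → Fin 2) : ℤ := (-1) ^ ((σ 0).val + (σ 2).val + (σ 4).val + (σ 6).val)

/-- Four times the bond term of `H φ` on the bond `{i, i+1}` at `σ`, coefficient of one power of `μ`
(`co` = the coefficient table of that power): parallel bond `ms(σ) co(σ)`, antiparallel bond
`−ms(σ) co(σ) + 2 ms(σ') co(σ')`, `σ' = σ ∘ swap i (i+1)`. -/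
def bondE (co : ℕ → ℤ) (σ : Fin 8 → Fin 2) (i : Fin 8) : ℤ :=
  if σ i = σ (i + 1) then msZ σ * co (cls (enc σ))
  else -(msZ σ * co (cls (enc σ))) +
    2 * (msZ (σ ∘ Equiv.swap i (i + 1)) * co (cls (enc (σ ∘ Equiv.swap i (i + 1)))))

/-- `4 (2 − μ/4)(a + b μ + c μ²) = (8a − 1600c) + (8b − a + 464c) μ + (8c − b − 40c) μ² − c (μ³ − 40μ² + 464μ − 1600)`:
the three right-hand coefficient tables. -/
def rhsA (k : ℕ) : ℤ := 8 * coefA k - 1600 * coefC k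
/-- see `rhsA` -/
def rhsB (k : ℕ) : ℤ := 8 * coefB k - coefA k + 464 * coefC k
/-- see `rhsA` -/
def rhsC (k : ℕ) : ℤ := 8 * coefC k - coefB k - 40 * coefC k

/-- The residual of the eigen-equation `4 (H φ)(σ) = 4 (2 − μ/4) φ(σ)` in one power of `μ`. -/
def resid (co rc : ℕ → ℤ) (σ : Fin 8 → Fin 2) : ℤ := (∑ i : Fin 8, bondE co σ i) - msZ σ * rc (cls (enc σ))

/-- The weight (number of down spins) of a configuration, written out. -/
def wt (σ : Fin 8 → Fin 2) : ℕ :=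
  (σ 0).val + (σ 1).val + (σ 2).val + (σ 3).val + (σ 4).val + (σ 5).val + (σ 6).val + (σ 7).val

set_option maxRecDepth 8000 in
/-- **Kernel evaluation**: the three integer residuals vanish on every weight-4 configuration (run over
the 256 masks). -/
theorem resid_cfg_eq_zero : ∀ m : Fin 256, wt (cfg m.val) = 4 →
    resid coefA rhsA (cfg m.val) = 0 ∧ resid coefB rhsB (cfg m.val) = 0 ∧ resid coefC rhsC (cfg m.val) = 0 := by
  decide

set_option maxRecDepth 8000 in
/-- Every configuration is the configuration of its mask (kernel evaluation over the 256 configurations). -/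
theorem cfg_enc : ∀ σ : Fin 8 → Fin 2, cfg (enc σ) = σ := by decide

set_option maxRecDepth 8000 in
/-- Masks are `< 256`. -/
theorem enc_lt : ∀ σ : Fin 8 → Fin 2, enc σ < 256 := by decide

end HeisenbergRing8

/-! ## §6 Assembly: the eigen-equation, the sector, Marshall positivity, and the ground-state energy -/

namespace HeisenbergRing8

open Summit.Ventures.CertifiedQuantumChemistry.Hamiltonians

/-- The explicit Perron vector `φ_μ(σ) = (−1)^{σ_0+σ_2+σ_4+σ_6} (a_k + b_k μ + c_k μ²)`, `k = cls σ`, on the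
weight-`4` configurations (zero elsewhere). -/
def vec (μ : ℝ) (σ : Fin 8 → Fin 2) : ℂ :=
  if wt σ = 4 then
    (msZ σ : ℂ) * ((coefA (cls (enc σ)) : ℂ) + (coefB (cls (enc σ)) : ℂ) * (μ : ℂ) +
      (coefC (cls (enc σ)) : ℂ) * (μ : ℂ) ^ 2)
  else 0

/-- The written-out weight is the weight `Σ_z σ_z`. -/
theorem wt_eq_sum (σ : Fin 8 → Fin 2) : wt σ = ∑ z, (σ z : ℕ) := by
  rw [Fin.sum_univ_eight]; rfl

set_option maxRecDepth 8000 in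
/-- Exchanging two spins preserves the weight (kernel evaluation). -/
theorem wt_comp_swap : ∀ (σ : Fin 8 → Fin 2) (i : Fin 8), wt (σ ∘ Equiv.swap i (i + 1)) = wt σ := by
  decide

set_option maxRecDepth 8000 in
/-- The Marshall exponent: `Σ_{x ∈ evenSites 8} σ_x = σ_0 + σ_2 + σ_4 + σ_6` (kernel evaluation). -/
theorem sum_evenSites_eq : ∀ σ : Fin 8 → Fin 2,
    (∑ x ∈ evenSites 8, (σ x : ℕ)) = (σ 0).val + (σ 2).val + (σ 4).val + (σ 6).val := by
  decide

set_option maxRecDepth 8000 in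
/-- The integer Marshall sign squares to one (kernel evaluation). -/
theorem msZ_mul_msZ : ∀ σ : Fin 8 → Fin 2, msZ σ * msZ σ = 1 := by decide

/-- The tree's Marshall sign of the even sublattice is the integer `msZ`. -/
theorem marshallSign_evenSites_eq (σ : Fin 8 → Fin 2) : marshallSign (evenSites 8) σ = (msZ σ : ℂ) := by
  rw [marshallSign, sum_evenSites_eq, msZ]
  push_cast
  rfl

/-- The three integer residuals vanish on every weight-`4` configuration. -/
theorem resid_eq_zero (σ : Fin 8 → Fin 2) (hσ : wt σ = 4) :
    resid coefA rhsA σ = 0 ∧ resid coefB rhsB σ = 0 ∧ resid coefC rhsC σ = 0 := by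
  have h := resid_cfg_eq_zero ⟨enc σ, enc_lt σ⟩
  rw [cfg_enc] at h
  exact h hσ

/-- Four times one bond term of `H φ_μ` at a weight-`4` configuration, as the integer combination `bondE`
of `1, μ, μ²`. -/
theorem four_mul_bondTerm (μ : ℝ) (σ : Fin 8 → Fin 2) (hσ : wt σ = 4) (i : Fin 8) :
    (4 : ℂ) * heisenbergBondTerm (vec μ) σ i (i + 1) =
      (bondE coefA σ i : ℂ) + (bondE coefB σ i : ℂ) * (μ : ℂ) + (bondE coefC σ i : ℂ) * (μ : ℂ) ^ 2 := by
  have hσ' : wt (σ ∘ Equiv.swap i (i + 1)) = 4 := by rw [wt_comp_swap]; exact hσ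
  unfold heisenbergBondTerm bondE vec
  by_cases h : σ i = σ (i + 1)
  · simp only [h, if_true, hσ]
    push_cast
    ring
  · simp only [h, if_false, hσ, hσ', if_true]
    push_cast
    ring

/-- **The eigen-equation** `H φ_μ = (2 − μ/4) φ_μ` for every real root `μ` of `x³ − 40x² + 464x − 1600`. -/
theorem mulVec_vec (μ : ℝ) (hμ : μ ^ 3 - 40 * μ ^ 2 + 464 * μ - 1600 = 0) :
    heisenbergHamiltonian 1 (ringGraph 8) 1 *ᵥ vec μ = ((2 - μ / 4 : ℝ) : ℂ) • vec μ := by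
  funext σ
  rw [Pi.smul_apply, smul_eq_mul, heisenbergHamiltonian_one_mulVec_apply, sum_edgeFinset_ringGraph_eight]
  simp only [Sym2.lift_mk, Complex.ofReal_one, one_mul]
  by_cases hσ : wt σ = 4
  · obtain ⟨hA, hB, hC⟩ := resid_eq_zero σ hσ
    have eA : ((∑ i : Fin 8, bondE coefA σ i : ℤ) : ℂ) = (msZ σ : ℂ) * (rhsA (cls (enc σ)) : ℂ) := by
      exact_mod_cast sub_eq_zero.1 hA
    have eB : ((∑ i : Fin 8, bondE coefB σ i : ℤ) : ℂ) = (msZ σ : ℂ) * (rhsB (cls (enc σ)) : ℂ) := by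
      exact_mod_cast sub_eq_zero.1 hB
    have eC : ((∑ i : Fin 8, bondE coefC σ i : ℤ) : ℂ) = (msZ σ : ℂ) * (rhsC (cls (enc σ)) : ℂ) := by
      exact_mod_cast sub_eq_zero.1 hC
    push_cast at eA eB eC
    have h4 : (4 : ℂ) * ∑ i : Fin 8, heisenbergBondTerm (vec μ) σ i (i + 1) =
        (∑ i : Fin 8, (bondE coefA σ i : ℂ)) + (∑ i : Fin 8, (bondE coefB σ i : ℂ)) * (μ : ℂ) +
          (∑ i : Fin 8, (bondE coefC σ i : ℂ)) * (μ : ℂ) ^ 2 := by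
      rw [Finset.mul_sum, Finset.sum_mul, Finset.sum_mul, ← Finset.sum_add_distrib, ← Finset.sum_add_distrib]
      exact Finset.sum_congr rfl fun i _ => four_mul_bondTerm μ σ hσ i
    rw [eA, eB, eC] at h4
    have hμ' : (μ : ℂ) ^ 3 - 40 * (μ : ℂ) ^ 2 + 464 * (μ : ℂ) - 1600 = 0 := by exact_mod_cast hμ
    have hv : vec μ σ = (msZ σ : ℂ) * ((coefA (cls (enc σ)) : ℂ) + (coefB (cls (enc σ)) : ℂ) * (μ : ℂ) +
        (coefC (cls (enc σ)) : ℂ) * (μ : ℂ) ^ 2) := if_pos hσ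
    apply mul_left_cancel₀ (by norm_num : (4 : ℂ) ≠ 0)
    rw [h4, hv, rhsA, rhsB, rhsC]
    push_cast
    linear_combination (msZ σ : ℂ) * (coefC (cls (enc σ)) : ℂ) * hμ'
  · have hv : vec μ σ = 0 := if_neg hσ
    have hv' : ∀ i : Fin 8, vec μ (σ ∘ Equiv.swap i (i + 1)) = 0 := fun i =>
      if_neg (by rw [wt_comp_swap]; exact hσ)
    rw [hv, mul_zero]
    refine Finset.sum_eq_zero fun i _ => ?_
    unfold heisenbergBondTerm
    rw [hv, hv' i]
    split_ifs <;> ring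

/-- `φ_μ` lies in the `S^z = 0` sector (weight `4 = |Λ|/2`). -/
theorem vec_mem (μ : ℝ) :
    vec μ ∈ spinZSector (Λ := Fin 8) 1 (((Fintype.card (Fin 8) * 1 : ℕ) : ℝ) / 2 - (4 : ℕ)) := by
  rw [LiebMattis.mem_spinZSector_weight_iff]
  intro σ hσ
  rw [← wt_eq_sum] at hσ
  exact if_neg hσ

/-- `φ_μ` of the Néel configuration `01010101` (class `6`) is `64`; in particular `φ_μ ≠ 0`. -/
theorem vec_neel (μ : ℝ) : vec μ (cfg 170) = 64 := by
  have h1 : wt (cfg 170) = 4 := by decide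
  have h2 : cls (enc (cfg 170)) = 6 := by decide
  have h3 : msZ (cfg 170) = 1 := by decide
  rw [vec, if_pos h1, h2, h3]
  simp [coefA, coefB, coefC]

/-- `φ_μ ≠ 0`. -/
theorem vec_ne_zero (μ : ℝ) : vec μ ≠ 0 := by
  intro h
  have := congrFun h (cfg 170)
  rw [vec_neel, Pi.zero_apply] at this
  norm_num at this

/-- **Positivity of the Perron vector's orbit values** for `μ ∈ [22.6, 22.61]`:
`a_k + b_k μ + c_k μ² > 0` for every class `k` (`≈ 1.20, 5.58, 8.76, 26.42, 22.04, 14.47, 64`). -/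
theorem coef_pos {μ : ℝ} (h1 : 22.6 ≤ μ) (h2 : μ ≤ 22.61) (k : ℕ) :
    0 < (coefA k : ℝ) + (coefB k : ℝ) * μ + (coefC k : ℝ) * μ ^ 2 := by
  rcases k with _ | _ | _ | _ | _ | _ | _ | k <;> simp [coefA, coefB, coefC] <;> nlinarith

/-- **Strict Marshall sign rule for `φ_μ`**: `(-1)^{Σ_{even x} σ_x} φ_μ(σ) = a_k + b_k μ + c_k μ² > 0` on every
weight-`4` configuration, for `μ ∈ [22.6, 22.61]`. -/
theorem marshall_pos {μ : ℝ} (h1 : 22.6 ≤ μ) (h2 : μ ≤ 22.61) (σ : Fin 8 → Fin 2)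
    (hσ : (∑ z, (σ z : ℕ)) = 4) :
    0 < (marshallSign (evenSites 8) σ * vec μ σ).re ∧ (marshallSign (evenSites 8) σ * vec μ σ).im = 0 := by
  rw [← wt_eq_sum] at hσ
  have hms : ((msZ σ : ℂ)) * (msZ σ : ℂ) = 1 := by exact_mod_cast msZ_mul_msZ σ
  have hval : marshallSign (evenSites 8) σ * vec μ σ =
      (((coefA (cls (enc σ)) : ℝ) + (coefB (cls (enc σ)) : ℝ) * μ + (coefC (cls (enc σ)) : ℝ) * μ ^ 2 : ℝ) : ℂ) := by
    rw [marshallSign_evenSites_eq, vec, if_pos hσ, ← mul_assoc, hms, one_mul]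
    push_cast
    ring
  rw [hval, Complex.ofReal_re, Complex.ofReal_im]
  exact ⟨coef_pos h1 h2 _, rfl⟩

/-- The 8-ring is bipartite in its even sites. -/
theorem ringGraph_eight_isBipartiteWith :
    (ringGraph 8).IsBipartiteWith ((evenSites 8 : Finset (Fin 8)) : Set (Fin 8)) (↑(evenSites 8))ᶜ where
  disjoint := disjoint_compl_right
  mem_of_adj := fun x y hxy => by
    have h := evenSites_bipartite 4 x y hxy
    simp only [Set.mem_compl_iff, Finset.mem_coe]
    by_cases hx : x ∈ evenSites 8
    · exact Or.inl ⟨hx, (h.1 hx)⟩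
    · exact Or.inr ⟨hx, by_contra fun hy => hx (h.2 hy)⟩

/-- **The `S^z = 0` sector energy of the 8-ring is `2 − μ/4`** for the root `μ ∈ [22.6, 22.61]` of the cubic. -/
theorem lowestEnergyInSector_eq {μ : ℝ} (hμ : μ ^ 3 - 40 * μ ^ 2 + 464 * μ - 1600 = 0) (h1 : 22.6 ≤ μ)
    (h2 : μ ≤ 22.61) :
    lowestEnergyInSector 1 (heisenbergHamiltonian 1 (ringGraph 8) 1)
      (((Fintype.card (Fin 8) * 1 : ℕ) : ℝ) / 2 - (4 : ℕ)) = 2 - μ / 4 :=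
  lowestEnergyInSector_eq_of_marshall_positive 1 (ringGraph 8) 1 (evenSites 8) (ringGraph_connected (by norm_num))
    ringGraph_eight_isBipartiteWith one_pos 4 ⟨cfg 170, by decide⟩ (vec_mem μ) (mulVec_vec μ hμ)
    (marshall_pos h1 h2)

/-- **T-H8(α), exact form.** For the root `μ ∈ [22.6, 22.61]` of `x³ − 40x² + 464x − 1600`:
`E₀(Σ_{i∈ℤ/8} 𝐒_i·𝐒_{i+1}) = 2 − μ/4`. -/
theorem groundEnergy_eq_of_root {μ : ℝ} (hμ : μ ^ 3 - 40 * μ ^ 2 + 464 * μ - 1600 = 0) (h1 : 22.6 ≤ μ)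
    (h2 : μ ≤ 22.61) : (heisenbergHamiltonian 1 (ringGraph 8) 1).groundEnergy = 2 - μ / 4 := by
  rw [← LiebMattis.lowestEnergyInSector_central_eq_groundEnergy 1 (ringGraph 8) 1 4 (by simp),
    lowestEnergyInSector_eq hμ h1 h2]

/-- The cubic `x³ − 40x² + 464x − 1600` has a root in `[22.6043736356, 22.6043736358]` (intermediate values). -/
theorem exists_root : ∃ μ : ℝ, μ ∈ Set.Icc (226043736356 / 10 ^ 10 : ℝ) (226043736358 / 10 ^ 10) ∧
    μ ^ 3 - 40 * μ ^ 2 + 464 * μ - 1600 = 0 := by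
  have hab : (226043736356 / 10 ^ 10 : ℝ) ≤ 226043736358 / 10 ^ 10 := by norm_num
  have hcont : ContinuousOn (fun x : ℝ => x ^ 3 - 40 * x ^ 2 + 464 * x - 1600)
      (Set.Icc (226043736356 / 10 ^ 10 : ℝ) (226043736358 / 10 ^ 10)) := by fun_prop
  have h0 : (0 : ℝ) ∈ Set.Icc ((fun x : ℝ => x ^ 3 - 40 * x ^ 2 + 464 * x - 1600) (226043736356 / 10 ^ 10))
      ((fun x : ℝ => x ^ 3 - 40 * x ^ 2 + 464 * x - 1600) (226043736358 / 10 ^ 10)) := by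
    constructor <;> norm_num
  obtain ⟨μ, hμ, hfμ⟩ := intermediate_value_Icc hab hcont h0
  exact ⟨μ, hμ, hfμ⟩

/-- **T-H8(α).** `E₀(Σ_{i∈ℤ/8} 𝐒_i·𝐒_{i+1}) = 2 − μ/4` with `μ³ − 40μ² + 464μ − 1600 = 0`,
`μ ∈ [22.6043736356, 22.6043736358]`. -/
theorem groundEnergy_eq : ∃ μ : ℝ, μ ∈ Set.Icc (226043736356 / 10 ^ 10 : ℝ) (226043736358 / 10 ^ 10) ∧
    μ ^ 3 - 40 * μ ^ 2 + 464 * μ - 1600 = 0 ∧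
    (heisenbergHamiltonian 1 (ringGraph 8) 1).groundEnergy = 2 - μ / 4 := by
  obtain ⟨μ, hμ, hp⟩ := exists_root
  exact ⟨μ, hμ, hp, groundEnergy_eq_of_root hp (by linarith [hμ.1]) (by linarith [hμ.2])⟩

/-- **T-H8(α), enclosure.** `E₀(Σ_{i∈ℤ/8} 𝐒_i·𝐒_{i+1}) ∈ [−3.65109340895, −3.6510934089]`. -/
theorem groundEnergy_mem_Icc : (heisenbergHamiltonian 1 (ringGraph 8) 1).groundEnergy ∈
    Set.Icc (-(365109340895 / 10 ^ 11 : ℝ)) (-(36510934089 / 10 ^ 10)) := by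
  obtain ⟨μ, hμ, -, hE⟩ := groundEnergy_eq
  rw [hE]
  constructor <;> linarith [hμ.1, hμ.2]

/-- **`h(8) ∈ [5.6510934089, 5.65109340895]`**, `h(8) := 2 − E₀(Σ_{i∈ℤ/8} 𝐒_i·𝐒_{i+1})` (HOME/STRUCTURE.md §2.2.3;
RULE ENC-8's h-input, there from the stdlib enclosure T-H8(β)). -/
theorem h8_mem_Icc : 2 - (heisenbergHamiltonian 1 (ringGraph 8) 1).groundEnergy ∈
    Set.Icc (56510934089 / 10 ^ 10 : ℝ) (565109340895 / 10 ^ 11) := by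
  obtain ⟨hlo, hhi⟩ := groundEnergy_mem_Icc
  constructor <;> linarith

/-- The root is unique in `[22.6, 22.61]` (a fortiori: it is `8 − 4E₀`). -/
theorem root_unique {μ ν : ℝ} (hμ : μ ^ 3 - 40 * μ ^ 2 + 464 * μ - 1600 = 0) (h1 : 22.6 ≤ μ) (h2 : μ ≤ 22.61)
    (hν : ν ^ 3 - 40 * ν ^ 2 + 464 * ν - 1600 = 0) (h3 : 22.6 ≤ ν) (h4 : ν ≤ 22.61) : μ = ν := by
  have h := (groundEnergy_eq_of_root hμ h1 h2).symm.trans (groundEnergy_eq_of_root hν h3 h4)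
  linarith

end HeisenbergRing8

end Summit.Ventures.CertifiedQuantumChemistry

end
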